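import Mathlib
import HarnessLib
import Summits.HubbardSuperconductivity.HubbardSuperconductivity.Theorems.KLProgrammeKLRegimeOverlapWtFlowAll
import Summits.HubbardSuperconductivity.HubbardSuperconductivity.Theorems.KLProgrammeKLRegimeEngineTowerPartialIncrLevStepFKlEng

/-!
# Route `KLProgramme` — crux K3 ENGINE (stmt-HubbardSuperconductivity-20437 `KLRegimeEngineV17F2`), stub (b) v2, THE LEVELS PACKAGE (ℓ), located item
# «(ℓ)-BLOCKLEN-CJ-UNIFORM» (k3c3-p2 g16, STATUS l.≈10760): THE OVERLAP CONSTANT `CJ` AND THE LINK DATA WITH `∃ CJ` BEFORE `∀ d`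
# (cell gate-hubbard-kl, seat hubbard-kl-k3c3-p2 g16; ∃-rescoping twins of …OverlapWtTower / …OverlapWtColFlowDeep / …OverlapWtFlowAll (tower doors) and of
#  `EngineV8.linkDataPartialF_klEng'` (…TowerPartialIncrLevStepFKlEng §3); proofs verbatim with the intro of `d` moved after the constants)

WHY.  The numerics side of the ∀j-assembly must choose the block length `d` so that the blocking row `max 1 Z · C₂² · max 4 (2τψ) ≤ 2^(d−1)` holds, and under
the KlEng pins `Z = e⁴·(81·CJ)²/8` (p4 g21, …TowerLevNumericsPins): `d ≥ d₀(C₂, CJ)`.  In the chain as landed, every statement takes `d` FIRST and seals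
`CJ` existentially afterwards (`overlapWt_towerBlock_klEng_flow_all (d R c'') : ∃ CJ, …`, hence `linkDataPartialF_klEng['] (d R c'') : ∃ Cκ Cb CJ, …`),
so formally `CJ = CJ(d)` and the choice is circular.  In value `CJ` does not depend on `d` (both deep doors take it from the `…_rate dd` theorems, `dd = 5`),
and neither does `Cκ` (the Gram door has no `d`); only the alpha constant `Cb` does.  This file re-scopes accordingly — nothing else changes:

* `TorusFourierL2.overlapWt_towerBlock_klEng_flow_deep_unif (dd)`, `…towerBlockCol_klEng_flow_deep_unif (dd)` — `∃ CJ, 0 < CJ ∧ ∀ d, <same body>`;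
* `TorusFourierL2.overlapWt_towerBlock_klEng_flow_all_unif (R c'')` — `∃ CJ, 0 < CJ ∧ ∀ d, <same body>`;
* **`EngineV8.linkDataPartialF_klEng_unif (R c'')`** — `∃ Cκ CJ, 0 < Cκ ∧ 0 < CJ ∧ ∀ d, ∃ Cb, 0 < Cb ∧ <body of linkDataPartialF_klEng'>` — the single data
  source for closer‴_klEng♯ / the ∀j-assembly with the block length chosen after `(C₂, CJ)`.
Compositions/re-scopings of landed theorems; nothing about the model is asserted beyond them; nothing asserts (ℓ), any stub, K3 or superconductivity.
References: BGM 2006 §2.7 (2.71a), §2.8 (2.77), (2.81)–(2.84) [cite: BenfattoGiulianiMastropietro2006].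
-/

noncomputable section

section Doors

namespace Summit.HubbardSuperconductivity.HubbardSuperconductivity.Theorems.TorusFourierL2

set_option linter.dupNamespace false -- summit = problem name (single-conjunct summit), D-0017

open Set Finset Literature.MathematicalPhysics.QuantumLattice Literature.MathematicalPhysics.QuantumLattice.BandSectorCounting
open Literature.MathematicalPhysics.QuantumLattice.FermiRG Literature.Probability.LatticeModels Literature.Analysis.SpecialFunctions
open Summit.HubbardSuperconductivity.HubbardSuperconductivity.Theorems.DispersionFlow
open Summit.HubbardSuperconductivity.HubbardSuperconductivity.Theorems.KLRegimeSplit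
open Summit.HubbardSuperconductivity.HubbardSuperconductivity.Theorems.KLProgrammeLegKernels
open Summit.HubbardSuperconductivity.HubbardSuperconductivity.Theorems.PerturbedFermiCurve
open Summit.HubbardSuperconductivity.HubbardSuperconductivity.Theorems.EngineV8
open Literature.Probability.LatticeModels.BattleFederbush
open scoped Real Nat

open Classical

/-! ## §1 The deep tower doors with `∃ CJ` before `∀ d` -/

/-- **d-UNIFORM form of `overlapWt_towerBlock_klEng_flow_deep`**: the same statement with `∃ CJ` BEFORE `∀ d` (the constant comes from
`overlapWt_jump_sums_klEng_flow_deep_rate dd`, which has no `d`). [cite: BenfattoGiulianiMastropietro2006, §2.7 (2.71a), §2.8 (2.77)] -/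
theorem overlapWt_towerBlock_klEng_flow_deep_unif (dd : ℕ) :
    ∃ CJ : ℝ, 0 < CJ ∧
      ∀ (d : ℕ) (G : GeoConsts) (P : SplitConsts) (R : RenConsts) (Q : EngConsts) (cc : ℝ), R.WF2 → 0 < cc → cc ≤ EngineV8.klEngC₃6 P R →
      ∀ μ ∈ klWindowC, ∀ U : ℝ, 0 < U → U ≤ min (EngineV8.klEngU₀3 P R cc) (1 / (R.Gfr 3 + 1)) →
      ∀ β : ℝ, klBetaMin ≤ β → β ≤ Real.exp (cc / U ^ 2) →
      ∀ (L M : ℕ) [NeZero L] [NeZero M], EngineV8.klEngL₃ β U ≤ L → EngineV8.klEngM₃ β U L ≤ M →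
      ∀ n : ℕ, 1 ≤ n → n ≤ nScales β + 1 →
        HistP klPredsV17F2 L M G P Q R β U μ 0 n → FrameOK R U (nScales β) μ (klFlowFrameU L M β U μ n) →
        ∀ k : ℕ, 1 ≤ d * k → ∀ J' : ℕ, d * k ≤ J' → J' ≤ n → (4 : ℝ) ^ n * U ≤ (4 : ℝ) ^ (2 * (d * k) + dd) → ∀ jw : ℕ, J' ≤ jw →
        (∀ X'' : SpaceTimeIdx L M × SectorLeg (sectorCount J'),
          ∑ X', ‖(sectorAnalysisMatrix L M β (klAnisoFamily L M β μ (klFlowFrameU L M β U μ n) klE0 J') *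
            sectorSubMatrix L M β (bgmFatMultiplier L M klE0 β (nambuXiCT L μ (klFlowFrameU L M β U μ n)) (d * k - 1))) X'' X'‖ *
              EngineV8.klScaleWt L M β jw {EngineV8.latticeLegPos (2 * (2 * M)) X'', EngineV8.latticeLegPos (2 * (2 * M)) X'} ≤
            81 * CJ * M / β) ∧
        (∀ (ω'' : Fin (sectorCount J')) (ω' : Fin (sectorCount (d * k - 1))) (σ c : Fin 2) (x' : SpaceTimeIdx L M),
          ∑ x'' : SpaceTimeIdx L M, ‖(sectorAnalysisMatrix L M β (klAnisoFamily L M β μ (klFlowFrameU L M β U μ n) klE0 J') *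
            sectorSubMatrix L M β (bgmFatMultiplier L M klE0 β (nambuXiCT L μ (klFlowFrameU L M β U μ n)) (d * k - 1)))
              (x'', ((ω'', σ), c)) (x', ((ω', σ), c))‖ *
              EngineV8.klScaleWt L M β jw
                {EngineV8.latticeLegPos (2 * (2 * M)) ((x'', ((ω'', σ), c)) : SpaceTimeIdx L M × SectorLeg (sectorCount J')),
                  EngineV8.latticeLegPos (2 * (2 * M)) ((x', ((ω', σ), c)) : SpaceTimeIdx L M × SectorLeg (sectorCount (d * k - 1)))} ≤
            3 * CJ * M / β) ∧
        (∀ (ω'' : Fin (sectorCount J')) (ω' : Fin (sectorCount (d * k - 1))) (σ c : Fin 2) (x'' : SpaceTimeIdx L M),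
          ∑ x' : SpaceTimeIdx L M, ‖(sectorAnalysisMatrix L M β (klAnisoFamily L M β μ (klFlowFrameU L M β U μ n) klE0 J') *
            sectorSubMatrix L M β (bgmFatMultiplier L M klE0 β (nambuXiCT L μ (klFlowFrameU L M β U μ n)) (d * k - 1)))
              (x'', ((ω'', σ), c)) (x', ((ω', σ), c))‖ *
              EngineV8.klScaleWt L M β jw
                {EngineV8.latticeLegPos (2 * (2 * M)) ((x'', ((ω'', σ), c)) : SpaceTimeIdx L M × SectorLeg (sectorCount J')),
                  EngineV8.latticeLegPos (2 * (2 * M)) ((x', ((ω', σ), c)) : SpaceTimeIdx L M × SectorLeg (sectorCount (d * k - 1)))} ≤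
            3 * CJ * M / β) := by
  obtain ⟨CJ, hCJ, h⟩ := overlapWt_jump_sums_klEng_flow_deep_rate dd
  refine ⟨CJ, hCJ, ?_⟩
  intro d G P R Q cc hR2 hcc hcc6 μ hμ U hU hUle β hβmin hβc L M _ _ hL3 hM3 n hn1 hnN hhist hfr k hdk J' hJ' hJn hnd jw hjw
  have e1 : d * k - 1 + 1 = d * k := by omega
  have h' := h G P R Q cc hR2 hcc hcc6 μ hμ U hU hUle β hβmin hβc L M hL3 hM3 n hn1 hnN hhist hfr (d * k - 1) J' (by omega) hJn
    (by rw [e1]; exact hnd) jw hjw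
  exact h'

/-- **d-UNIFORM form of `overlapWt_towerBlockCol_klEng_flow_deep`** (`∃ CJ` before `∀ d`; constant from `overlapWt_colSum_klEng_flow_deep_rate dd`).
[cite: BenfattoGiulianiMastropietro2006, §2.7 (2.71a), §2.8 (2.77)] -/
theorem overlapWt_towerBlockCol_klEng_flow_deep_unif (dd : ℕ) :
    ∃ CJ : ℝ, 0 < CJ ∧
      ∀ (d : ℕ) (G : GeoConsts) (P : SplitConsts) (R : RenConsts) (Q : EngConsts) (cc : ℝ), R.WF2 → 0 < cc → cc ≤ EngineV8.klEngC₃6 P R →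
      ∀ μ ∈ klWindowC, ∀ U : ℝ, 0 < U → U ≤ min (EngineV8.klEngU₀3 P R cc) (1 / (R.Gfr 3 + 1)) →
      ∀ β : ℝ, klBetaMin ≤ β → β ≤ Real.exp (cc / U ^ 2) →
      ∀ (L M : ℕ) [NeZero L] [NeZero M], EngineV8.klEngL₃ β U ≤ L → EngineV8.klEngM₃ β U L ≤ M →
      ∀ n : ℕ, 1 ≤ n → n ≤ nScales β + 1 →
        HistP klPredsV17F2 L M G P Q R β U μ 0 n → FrameOK R U (nScales β) μ (klFlowFrameU L M β U μ n) →
        ∀ k : ℕ, 1 ≤ d * k → ∀ J' : ℕ, d * k ≤ J' → J' ≤ n → (4 : ℝ) ^ n * U ≤ (4 : ℝ) ^ (2 * (d * k) + dd) → ∀ jw : ℕ, J' ≤ jw →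
        ∀ X' : SpaceTimeIdx L M × SectorLeg (sectorCount (d * k - 1)),
          ∑ X'' : SpaceTimeIdx L M × SectorLeg (sectorCount J'),
            ‖(sectorAnalysisMatrix L M β (klAnisoFamily L M β μ (klFlowFrameU L M β U μ n) klE0 J') *
              sectorSubMatrix L M β (bgmFatMultiplier L M klE0 β (nambuXiCT L μ (klFlowFrameU L M β U μ n)) (d * k - 1))) X'' X'‖ *
              EngineV8.klScaleWt L M β jw {EngineV8.latticeLegPos (2 * (2 * M)) X'', EngineV8.latticeLegPos (2 * (2 * M)) X'} ≤
            81 * (2 : ℝ) ^ (J' - (d * k - 1)) * CJ * M / β := by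
  obtain ⟨CJ, hCJ, h⟩ := overlapWt_colSum_klEng_flow_deep_rate dd
  refine ⟨CJ, hCJ, ?_⟩
  intro d G P R Q cc hR2 hcc hcc6 μ hμ U hU hUle β hβmin hβc L M _ _ hL3 hM3 n hn1 hnN hhist hfr k hdk J' hJ' hJn hnd jw hjw X'
  have e1 : d * k - 1 + 1 = d * k := by omega
  exact h G P R Q cc hR2 hcc hcc6 μ hμ U hU hUle β hβmin hβc L M hL3 hM3 n hn1 hnN hhist hfr (d * k - 1) J' (by omega) hJn
    (by rw [e1]; exact hnd) jw hjw X'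

/-! ## §2 The tower door at the flow frame with `∃ CJ` before `∀ d` -/

/-- **d-UNIFORM form of `overlapWt_towerBlock_klEng_flow_all`**: `∃ CJ, 0 < CJ ∧ ∀ d, …` — `CJ := Cr + Cc + Ct` with the three constants taken from the
d-free deep doors (`…_flow_deep_unif 5`, `…Col_flow_deep_unif 5`) and `overlapWt_rows_cols_klEng_meanFreeFinal 5 R c''`; proof otherwise verbatim.
[cite: BenfattoGiulianiMastropietro2006, §2.7 (2.71a), §2.8 (2.77)] -/
theorem overlapWt_towerBlock_klEng_flow_all_unif (R : RenConsts) (c'' : ℝ) (hc'' : 0 ≤ c'') :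
    ∃ CJ : ℝ, 0 < CJ ∧
      ∀ (d : ℕ) (G : GeoConsts) (P : SplitConsts) (Q : EngConsts) (cc : ℝ), R.WF2 → 0 < cc → cc ≤ EngineV8.klEngC₃6 P R →
      ∀ μ ∈ klWindowC, ∀ U : ℝ, 0 < U → U ≤ min (EngineV8.klEngU₀3 P R cc) (1 / (R.Gfr 3 + 1)) → c'' * U ≤ 1 →
      ∀ β : ℝ, klBetaMin ≤ β → β ≤ Real.exp (cc / U ^ 2) →
      ∀ (L M : ℕ) [NeZero L] [NeZero M], EngineV8.klEngL₃ β U ≤ L → EngineV8.klEngM₃ β U L ≤ M →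
      ∀ n : ℕ, 1 ≤ n → n ≤ nScales β + 1 → IsKLRegime U cc (-(n : ℤ)) → HistP klPredsV17F2 L M G P Q R β U μ 0 n →
        (∀ m, 1 ≤ m → m < n → FlowPieceOscAt L M c'' β U μ m) →
        ∀ k : ℕ, 1 ≤ d * k → d * k ≤ n → ∀ jw : ℕ, d * k ≤ jw →
        (∀ X'' : SpaceTimeIdx L M × SectorLeg (sectorCount (d * k)),
          ∑ X', ‖(sectorAnalysisMatrix L M β (klAnisoFamily L M β μ (klFlowFrameU L M β U μ n) klE0 (d * k)) *
            sectorSubMatrix L M β (bgmFatMultiplier L M klE0 β (nambuXiCT L μ (klFlowFrameU L M β U μ n)) (d * k - 1))) X'' X'‖ *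
              EngineV8.klScaleWt L M β jw {EngineV8.latticeLegPos (2 * (2 * M)) X'', EngineV8.latticeLegPos (2 * (2 * M)) X'} ≤
            81 * CJ * M / β) ∧
        (∀ X' : SpaceTimeIdx L M × SectorLeg (sectorCount (d * k - 1)),
          ∑ X'' : SpaceTimeIdx L M × SectorLeg (sectorCount (d * k)),
            ‖(sectorAnalysisMatrix L M β (klAnisoFamily L M β μ (klFlowFrameU L M β U μ n) klE0 (d * k)) *
              sectorSubMatrix L M β (bgmFatMultiplier L M klE0 β (nambuXiCT L μ (klFlowFrameU L M β U μ n)) (d * k - 1))) X'' X'‖ *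
              EngineV8.klScaleWt L M β jw {EngineV8.latticeLegPos (2 * (2 * M)) X'', EngineV8.latticeLegPos (2 * (2 * M)) X'} ≤
            81 * (2 : ℝ) ^ (d * k - (d * k - 1)) * CJ * M / β) := by
  have ha : (-4 : ℝ) < -(6 / 5) := by norm_num
  have hab : (-(6 / 5) : ℝ) ≤ -(1 / 10) := by norm_num
  have hb : (-(1 / 10) : ℝ) < 0 := by norm_num
  obtain ⟨Cr, hCr, hdeepR⟩ := overlapWt_towerBlock_klEng_flow_deep_unif 5
  obtain ⟨Cc, hCc, hdeepC⟩ := overlapWt_towerBlockCol_klEng_flow_deep_unif 5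
  obtain ⟨Ct, hCt, htel⟩ := overlapWt_rows_cols_klEng_meanFreeFinal 5 R c'' hc''
  refine ⟨Cr + Cc + Ct, by positivity, ?_⟩
  intro d G P Q cc hR2 hcc hcc6 μ hμ U hU hUle hcU β hβmin hβc L M _ _ hL3 hM3 n hn1 hnN hreg hhist hosc k hdk hkn jw hjw
  have hRj : ∀ i, 0 ≤ R.Gfr i := EngineV8.gfr_nonneg_of_wf2 hR2
  have hU1 : U ≤ 1 :=
    ((hUle.trans (min_le_left _ _)).trans (EngineV8.klEngU₀3_le_symbolU₀ ha hab hb P hRj cc)).trans (min_le_left _ _)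
  have hβ0 : 0 < β := pos_of_klBetaMin_le hβmin
  have hM0 : (0 : ℝ) < M := Nat.cast_pos.2 (Nat.pos_of_ne_zero (NeZero.ne M))
  have hMβ : 0 ≤ (M : ℝ) / β := by positivity
  have hfrac : ∀ {a b : ℝ}, a ≤ b → a * M / β ≤ b * M / β := fun h =>
    div_le_div_of_nonneg_right (mul_le_mul_of_nonneg_right h hM0.le) hβ0.le
  have h2pos : 0 ≤ (2 : ℝ) ^ (d * k - (d * k - 1)) := by positivity
  have hmonoR : 81 * Cr * M / β ≤ 81 * (Cr + Cc + Ct) * M / β := hfrac (by linarith)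
  have hmonoT : 81 * Ct * M / β ≤ 81 * (Cr + Cc + Ct) * M / β := hfrac (by linarith)
  have hmonoC : 81 * (2 : ℝ) ^ (d * k - (d * k - 1)) * Cc * M / β ≤ 81 * (2 : ℝ) ^ (d * k - (d * k - 1)) * (Cr + Cc + Ct) * M / β :=
    hfrac (mul_le_mul_of_nonneg_left (by linarith) (by positivity))
  have hmonoTC : 162 * Ct * M / β ≤ 81 * (2 : ℝ) ^ (d * k - (d * k - 1)) * (Cr + Cc + Ct) * M / β := by
    refine hfrac ?_
    rw [show d * k - (d * k - 1) = 1 by omega, pow_one]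
    linarith
  by_cases hwin : (4 : ℝ) ^ n * U ≤ (4 : ℝ) ^ (2 * (d * k) + 5)
  · -- on the deep window: p3's constants at `K_n`
    have hfr : FrameOK R U (nScales β) μ (klFlowFrameU L M β U μ n) := frameOK_klFlowFrameU_of_histP_le hR2 hn1 le_rfl hnN hhist
    have hrow := (hdeepR d G P R Q cc hR2 hcc hcc6 μ hμ U hU hUle β hβmin hβc L M hL3 hM3 n hn1 hnN hhist hfr k hdk (d * k) le_rfl hkn hwin jw hjw).1
    have hcol := hdeepC d G P R Q cc hR2 hcc hcc6 μ hμ U hU hUle β hβmin hβc L M hL3 hM3 n hn1 hnN hhist hfr k hdk (d * k) le_rfl hkn hwin jw hjw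
    exact ⟨fun X'' => (hrow X'').trans hmonoR, fun X' => (hcol X').trans hmonoC⟩
  · -- below it: the (W4) telescope from the base index `m₀`, read at `K_n` through the model congruence, at the weaker rate `jw`
    obtain ⟨m₀, hm1, hmn, hdepth, hwin₀⟩ := exists_overlap_base_index_of_not_window hU1 hn1 hwin
    have e1 : d * k - 1 + 1 = d * k := by omega
    have h := htel G P Q cc hR2 hcc hcc6 μ hμ U hU hUle hcU β hβmin hβc L M hL3 hM3 n hnN hreg hhist hosc m₀ hm1 hmn (d * k - 1)
      (by rw [e1]; exact hdepth) (by rw [e1]; exact hwin₀)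
    rw [e1] at h
    obtain ⟨hrow, hcol⟩ := h
    have hK : ∀ q : TorusSite 2 L,
        (fsub (klFlowFrameU L M β U μ n) (symInterp L fun _ =>
            ∑ m ∈ Ico n n, klAngularMean (klLocalPart L M β U μ (klFlowFrameU L M β U μ m) m))).eval (latticeMomentum L q) =
          (klFlowFrameU L M β U μ n).eval (latticeMomentum L q) := fun q =>
      eval_fsub_symInterp_sum_Ico_self _ _ n _
    have hxi := nambuXiCT_congr L μ hK
    have hfam := klAnisoFamily_congr L M hK β μ klE0 (d * k)
    rw [hxi, hfam] at hrow hcol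
    -- the weaker rate
    have hwt : ∀ S : Finset (ZMod (2 * (2 * M)) × TorusSite 2 L), EngineV8.klScaleWt L M β jw S ≤ EngineV8.klScaleWt L M β (d * k) S :=
      fun S => klScaleWt_le_of_le β hjw S
    refine ⟨fun X'' => ?_, fun X' => ?_⟩
    · refine le_trans (Finset.sum_le_sum fun X' _ => mul_le_mul_of_nonneg_left (hwt _) (norm_nonneg _)) ((hrow X'').trans hmonoT)
    · refine le_trans (Finset.sum_le_sum fun X'' _ => mul_le_mul_of_nonneg_left (hwt _) (norm_nonneg _)) ((hcol X').trans hmonoTC)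

end Summit.HubbardSuperconductivity.HubbardSuperconductivity.Theorems.TorusFourierL2

end Doors

/-! ## §3 The link data with `∃ Cκ CJ` before `∀ d` -/

namespace Summit.HubbardSuperconductivity.HubbardSuperconductivity.Theorems.EngineV8

set_option linter.dupNamespace false -- summit = problem name (single-conjunct summit), D-0017

open Classical
open Real Finset Literature.MathematicalPhysics.QuantumLattice Literature.Probability.LatticeModels GrassmannAlgebra
open Literature.MathematicalPhysics.QuantumLattice.FermiRG Literature.MathematicalPhysics.QuantumLattice.FermiRG.BGM2006Routing
open Summit.HubbardSuperconductivity.HubbardSuperconductivity.Theorems.KLProgrammeLegKernels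
open Summit.HubbardSuperconductivity.HubbardSuperconductivity.Theorems.KLRegimeSplit
open Summit.HubbardSuperconductivity.HubbardSuperconductivity.Theorems.KLRegimeWick
open Summit.HubbardSuperconductivity.HubbardSuperconductivity.Theorems.TwoPointAssembly
open Summit.HubbardSuperconductivity.HubbardSuperconductivity.Theorems.DispersionFlow
open Summit.HubbardSuperconductivity.HubbardSuperconductivity.Theorems.TorusFourierL2

variable {L M : ℕ} [NeZero L] [NeZero M]

/-- **d-UNIFORM form of `linkDataPartialF_klEng'`** («(ℓ)-BLOCKLEN-CJ-UNIFORM»): `∃ Cκ CJ` (both d-free: the Gram door and the uniform overlap door) BEFORE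
`∀ d`, then `∃ Cb` (the alpha door's constant genuinely depends on the block length) — so that the numerics can choose `d ≥ d₀(C₂, CJ)` for the blocking
row AFTER `CJ` is in hand; body and proof otherwise those of `linkDataPartialF_klEng'`. [cite: BenfattoGiulianiMastropietro2006, §2.7 (2.71a), §2.8 (2.77), (2.81)-(2.83)] -/
theorem linkDataPartialF_klEng_unif (R : RenConsts) (c'' : ℝ) (hc'' : 0 < c'') :
    ∃ Cκ CJ : ℝ, 0 < Cκ ∧ 0 < CJ ∧ ∀ d : ℕ, ∃ Cb : ℝ, 0 < Cb ∧
      ∀ (G : GeoConsts) (P : SplitConsts) (Q : EngConsts) (c : ℝ), P.WF → R.WF2 → 0 < c → c ≤ klEngC₃6 P R →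
      ∀ μ ∈ klWindowC, ∀ U : ℝ, 0 < U → U ≤ klEngU₀9 P R c → c'' * U ≤ 1 →
      ∀ β : ℝ, klBetaMin ≤ β → β ≤ Real.exp (c / U ^ 2) →
      ∀ (L M : ℕ) [NeZero L] [NeZero M], klEngL₃ β U ≤ L → klEngM₃ β U L ≤ M →
      ∀ n : ℕ, 1 ≤ n → n ≤ nScales β + 1 → IsKLRegime U c (-(n : ℤ)) →
        HistP klPredsV17F2 L M G P Q R β U μ 0 n → FrameOK R U (nScales β) μ (klFlowFrameU L M β U μ n) →
        (∀ m, 1 ≤ m → m < n → FlowPieceOscAt L M c'' β U μ m) →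
      ∀ k : ℕ, 1 ≤ k → 2 ≤ d * k → d * k ≤ n → ∀ j : ℕ, d * k ≤ j → j ≤ d * (k + 1) → j ≤ nScales β + 1 →
        0 < Real.sqrt (Cκ * (klScale klE0 (d * k) / klScale klE0 (d * k - 1)) * (klE0 * ((8 : ℝ) ^ (d * k - 1))⁻¹)) ∧
        Real.sqrt (Cκ * (klScale klE0 (d * k) / klScale klE0 (d * k - 1)) * (klE0 * ((8 : ℝ) ^ (d * k - 1))⁻¹)) ^ 2 * (8 : ℝ) ^ (d * k) ≤ Real.sqrt (2 * Cκ * klE0) ^ 2 ∧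
        IsGramBoundedR ((sectorSubMatrix L M β (bgmFatMultiplier L M klE0 β (nambuXiCT L μ (klFlowFrameU L M β U μ n)) (d * k - 1))).transpose * hubbardCovSliceCT L M β μ 0 (klFlowFrameU L M β U μ n) (klScale klE0 j) (klScale klE0 (d * k)) * sectorSubMatrix L M β (bgmFatMultiplier L M klE0 β (nambuXiCT L μ (klFlowFrameU L M β U μ n)) (d * k - 1))) (Real.sqrt (Cκ * (klScale klE0 (d * k) / klScale klE0 (d * k - 1)) * (klE0 * ((8 : ℝ) ^ (d * k - 1))⁻¹))) ∧
        (∀ X, ∑ Y, ‖((sectorSubMatrix L M β (bgmFatMultiplier L M klE0 β (nambuXiCT L μ (klFlowFrameU L M β U μ n)) (d * k - 1))).transpose * hubbardCovSliceCT L M β μ 0 (klFlowFrameU L M β U μ n) (klScale klE0 j) (klScale klE0 (d * k)) * sectorSubMatrix L M β (bgmFatMultiplier L M klE0 β (nambuXiCT L μ (klFlowFrameU L M β U μ n)) (d * k - 1))) X Y‖ ≤ Cb * ((M : ℝ) / β) / klScale klE0 j) ∧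
        (∀ Y, ∑ X, ‖((sectorSubMatrix L M β (bgmFatMultiplier L M klE0 β (nambuXiCT L μ (klFlowFrameU L M β U μ n)) (d * k - 1))).transpose * hubbardCovSliceCT L M β μ 0 (klFlowFrameU L M β U μ n) (klScale klE0 j) (klScale klE0 (d * k)) * sectorSubMatrix L M β (bgmFatMultiplier L M klE0 β (nambuXiCT L μ (klFlowFrameU L M β U μ n)) (d * k - 1))) X Y‖ ≤ Cb * ((M : ℝ) / β) / klScale klE0 j) ∧
        Cb * ((M : ℝ) / β) / klScale klE0 j ≤ Cb * ((M : ℝ) / β) * (4 : ℝ) ^ d / klE0 * (4 : ℝ) ^ (d * k) ∧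
        (∀ X'', ∑ X', ‖(sectorAnalysisMatrix L M β (klAnisoFamily L M β μ (klFlowFrameU L M β U μ n) klE0 (d * k)) * sectorSubMatrix L M β (bgmFatMultiplier L M klE0 β (nambuXiCT L μ (klFlowFrameU L M β U μ n)) (d * k - 1))) X'' X'‖ ≤ 81 * CJ * M / β) ∧
        (∀ X', ∑ X'', ‖(sectorAnalysisMatrix L M β (klAnisoFamily L M β μ (klFlowFrameU L M β U μ n) klE0 (d * k)) * sectorSubMatrix L M β (bgmFatMultiplier L M klE0 β (nambuXiCT L μ (klFlowFrameU L M β U μ n)) (d * k - 1))) X'' X'‖ ≤ 162 * CJ * M / β) := by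
  obtain ⟨Cκ, hCκ, hg⟩ := gram_sliceCT_bgmFat_sharp_klEng
  obtain ⟨CJ, hCJ, hop⟩ := TorusFourierL2.overlapWt_towerBlock_klEng_flow_all_unif R c'' hc''.le
  refine ⟨Cκ, CJ, hCκ, hCJ, fun d => ?_⟩
  obtain ⟨Cb, hCb, hαp⟩ := TorusFourierL2.alphaWt_blockSliceCT_bgmFat_klEng_flow_all' d R c'' hc''
  refine ⟨Cb, hCb, ?_⟩
  intro G P Q c hP hR2 hc hc6 μ hμ U hU hU9 hcU β hβmin hβc L M _ _ hL3 hM3 n hn1 hnN hreg hhist hfr hosc k hk1 hdk hkn j hj hjk hkN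
  have he : (0 : ℝ) < klE0 := by norm_num [klE0]
  have hβ : 0 < β := KLRegimeSplit.pos_of_klBetaMin_le hβmin
  have hM0 : (0 : ℝ) < M := Nat.cast_pos.2 (Nat.pos_of_ne_zero (NeZero.ne M))
  have hU4 : U ≤ klEngU₀4 P R c := hU9.trans (klEngU₀9_le_klEngU₀4 P R c)
  have hU3g : U ≤ min (klEngU₀3 P R c) (1 / (R.Gfr 3 + 1)) :=
    le_min (hU9.trans (klEngU₀9_le_klEngU₀3 P R c)) (hU9.trans (klEngU₀9_le_inv_gfr_add_one P hR2.wf c (by norm_num)))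
  have hc3 : c ≤ klEngC₃3 P R := hc6.trans (klEngC₃6_le_klEngC₃3 P R)
  set K : TrigPolyC4v := klFlowFrameU L M β U μ n with hKdef
  have e1 : d * k - 1 + 1 = d * k := by omega
  have hmul : d * (k + 1) = d * k + d := Nat.mul_succ d k
  obtain ⟨hrow, hcol⟩ := hαp G P Q c hR2 hc hc6 μ hμ U hU hU3g hcU β hβmin hβc L M hL3 hM3 n hn1 hnN hreg hhist hosc (d * k - 1) (by omega) j
    (by omega) (by omega) (by omega) (d * k) (by omega)
  rw [e1] at hrow hcol
  obtain ⟨hrow', hcol'⟩ := hop d G P Q c hR2 hc hc6 μ hμ U hU hU3g hcU β hβmin hβc L M hL3 hM3 n hn1 hnN hreg hhist hosc k (by omega) hkn (d * k) le_rfl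
  refine ⟨?_, ?_, ?_, ?_, ?_, ?_, ?_, ?_⟩
  · have h1 : 0 < klScale klE0 (d * k) := klth_klScale_pos _
    have h2 : 0 < klScale klE0 (d * k - 1) := klth_klScale_pos _
    exact Real.sqrt_pos.2 (by positivity)
  · rw [gramF_sq_mul_pow_eq hCκ.le (by omega)]
  · have hΛpos : 0 < klScale klE0 j := klth_klScale_pos _
    have hΛle : klScale klE0 j ≤ klScale klE0 (d * k) := klScale_le_klScale he.le hj
    have hΛle' : klScale klE0 (d * k) ≤ klScale klE0 (d * k - 1) := klScale_le_klScale he.le (by omega)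
    obtain ⟨m, hm⟩ : ∃ m, d * k - 1 = m + 1 := ⟨d * k - 2, by omega⟩
    have h := (hg P R c hP hR2 hc hc3 μ hμ U hU hU4 β hβmin hβc K hfr L M hL3 hM3 m (by omega)
      (klScale klE0 j) (klScale klE0 (d * k)) hΛpos hΛle (by rw [← hm]; exact hΛle')).2.1
    rw [← hm] at h
    exact h
  · exact fun X => sum_norm_le_of_sum_norm_mul_klScaleWt_le _ _ β (d * k) _ (hrow X)
  · exact fun Y => sum_norm_le_of_sum_norm_mul_klScaleWt_le _ _ β (d * k) _ (hcol Y)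
  · have hΛj : klScale klE0 (d * (k + 1)) ≤ klScale klE0 j := klScale_le_klScale he.le hjk
    have hpos : 0 < klScale klE0 (d * (k + 1)) := klth_klScale_pos _
    calc Cb * ((M : ℝ) / β) / klScale klE0 j ≤ Cb * ((M : ℝ) / β) / klScale klE0 (d * (k + 1)) :=
          div_le_div_of_nonneg_left (by positivity) hpos hΛj
      _ = _ := alphaF_eq_bound_mul_pow Cb _ d k
  · exact fun X'' => sum_norm_le_of_sum_norm_mul_klScaleWt_le _ _ β (d * k) _ (hrow' X'')
  · have h2 : (2 : ℝ) ^ (d * k - (d * k - 1)) = 2 := by rw [show d * k - (d * k - 1) = 1 by omega, pow_one]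
    intro X'
    have h := sum_norm_le_of_sum_norm_mul_klScaleWt_le _ _ β (d * k) _ (hcol' X')
    rw [h2] at h
    exact h.trans (le_of_eq (by ring))

end Summit.HubbardSuperconductivity.HubbardSuperconductivity.Theorems.EngineV8

end
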